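import Literature.AlgebraicGeometry.HodgeTheory.ExteriorSumPolarizationHardLefschetz
import Literature.AlgebraicGeometry.HodgeTheory.MotivatedClassesPullbackFstBelowMiddle
import Literature.AlgebraicGeometry.HodgeTheory.MotivatedClassesPullbackFstCore
import Literature.AlgebraicGeometry.HodgeTheory.MotivatedClassesPullbackFstReduction
import Literature.AlgebraicGeometry.HodgeTheory.MotivatedClassesPullbackGraph
import Literature.AlgebraicGeometry.HodgeTheory.AlgebraicClassesPullbackHolds
import HarnessLib

/-!
# André 1996 Prop. 2.1 (ii): MOTIVATED CLASSES ARE STABLE UNDER PULL-BACK (singular cohomology of smooth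
# projective complex varieties); the named fact `Andre1996_motivatedClasses_pullback` DISCHARGED

research route conditional on HC_CM; not a corollary; Q11.4-sentence-2 already refuted in dim ≥ 3.
Cell `pub-hodge-ring2` (Hodge ladder STAGE 3), seat `ring2-b05` (binder row b05
`Ring2.Hypotheses.MotivatedImpliesAlgebraicAV`), gen 34. `HC_CM` (`Theses.RankFourFaces.CMAbelianHodge`) does not
occur in this file; nothing here proves a case of the Hodge conjecture; the row b05 stays OPEN.

What is discharged. The leaf (A5) `HodgeTheory.Andre1996_motivatedClasses_pullback` (Y. André, *Pour une
théorie inconditionnelle des motifs*, Publ. Math. IHÉS 83 (1996), Prop. 2.1 (ii) with p. 15: for a morphism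
`j : X ⟶ X̄` of smooth projective complex varieties, `j^*(A_motᵖ(X̄)_ℂ) ⊆ A_motᵖ(X)_ℂ`) of the tree's
derivation of André's deformation theorem `Andre1996_deformation` (Thm. 0.5; fact c24 of the cell's
BINDER-OWNERS table, `HodgeTheory/MotivatedClassesDeformationLeaves.Andre1996_deformation_holds_of`) — a
hypothesis `(hD : Andre1996_deformation)` is displayed by every row of the b05 module
`Ring2HypothesesDescentMotivatedVariational`. The tree had reduced (A5) on the real carriers
(`Theorems/HeckePrymWeilSummitOffWeilSector{AndreMotivatedPullback, MotivatedPullbackFstReduction,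
MotivatedPullbackFstCore, MotivatedPullbackFstBelowMiddle}`) to the multiplicativity of algebraic classes
(`Voisin2003_cupProduct_algebraicClasses`, PROVED: `Theorems.Voisin2003_cupProduct_algebraicClasses_holds`) and
ONE span statement `h132` (André's Lemme 1.3.2 for the pair `(*_η β, [Z])`), proved there for `b ≤ b'`; the
half `b > b'` needed the hard Lefschetz property of the exterior sum `η_Z ⊠ 1 + 1 ⊠ η`, now a theorem
(`isPolarizationClass_boxSum`, `Theorems/Ring2HypothesesDescentMotivatedExteriorSumHardLefschetz`).

* §1 `lefschetzPowTo_boxSum_cross_mem_span`, `span_boxSum_cross_le_algebraicClasses` — the "top-slice"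
  computation: for `θ = θ_Z ⊠ 1 + 1 ⊠ η`, `L_θᴹ (a ⊠ L_ηᵗ z)` stays in the span of the classes
  `a' ⊠ L_η^{t'} z` (`a'` algebraic on `Z`, binomial expansion of `L_θ = L ⊗ 1 + 1 ⊗ L`), and for
  `M = l + N` every such class is algebraic as soon as `L_ηᵗ z` is algebraic for `t ≥ N` (`H^{>2l}(Z) = 0`);
* §2 `lemma132_pair_of_lt` — **`h132` above the middle degree**: for `β ∈ Nᵇ H²ᵇ(W)`, `b' < b`, the class
  `S = pr_W^*(*_η β)` (`*_η β = (L_η^{b-b'})⁻¹ β`, André §1.1) equals `1 ∪ *_θ(L_θ^{l+b-b'} S)` with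
  `L_θ^{l+b-b'} S` ALGEBRAIC on `Z ⊗ W` (§1), `θ` the exterior-sum polarisation; `lemma132_pair` — both halves;
* §3 `motivatedPullbackFst_core` (the Künneth core `hcore` of `…MotivatedPullbackFstReduction`),
  **`map_fst_mem_motivatedClasses`** (`pr_X^*(A_motᵖ(X)) ⊆ A_motᵖ(X ⊗ Z)`, André Prop. 2.1 (ii), first
  inclusion), `map_snd_mem_motivatedClasses`, and, under its EXACT name,
  **`Literature.AlgebraicGeometry.HodgeTheory.Andre1996_motivatedClasses_pullback_holds`** (the named
  fact, via the graph formalism `andreMotivatedPullback_of_cupProduct_of_mapFst`), `map_mem_motivatedClasses`.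

No definition, no new named fact, no sorry. Honest column: this discharges ONE of the three open leaves
{c17 `deligne_globalInvariantCycles`, A3 `Andre1996_exists_motivated_of_motivated_pullback`, A5} of c24; c24
itself, row b05 and «10 · 0» are unmoved.

References: Andre1996Motifs (§1.1 p. 10, §1.3 Lemme 1.3.2 p. 13, §2.1 Prop. 2.1 (ii) p. 14 and proof p. 15),
Kleiman1968AlgebraicCycles (Thm. 2.9), VoisinHodgeII2003 (§9.2.4 Prop. 9.20), FultonYoungTableaux1997
(App. B §B.1 (5)–(7)), HatcherAT2002 (§3.2 Thm. 3.16).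

Provenance: Literature home (family `hodge`, layer `Literature/AlgebraicGeometry/HodgeTheory`, namespace
`Literature.AlgebraicGeometry.HodgeTheory.MotivatedPullback`) of the Summits-side `Theorems/Ring2HypothesesDescentMotivatedPullback` (cell `pub-hodge-ring2` ∕ route files
`HeckePrymWeilSummitOffWeilSector*`, the tree's derivation of André 1996 Prop. 2.1 (ii): motivated classes are stable
under pull-back), which `Literature/` may not import; theorems only, no named fact, no definition. Nothing here bears
on `HC_CM`; no case of the Hodge conjecture is proved. Lane `lit-hodgefound`, seat p20.
-/

noncomputable section

open _root_.CategoryTheory _root_.AlgebraicGeometry MonoidalCategory CartesianMonoidalCategory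
open Literature.AlgebraicTopology.SingularHomology Literature.Geometry.Kaehler
open Literature.AlgebraicGeometry Literature.AlgebraicGeometry.Motives
  Literature.AlgebraicGeometry.HodgeTheory

namespace Literature.AlgebraicGeometry.HodgeTheory.MotivatedPullback

/-! ## §1 The top slice: `L_θᴹ` on the classes `a ⊠ L_ηᵗ z` -/

section TopSlice

variable {l d : ℕ} {Z W : SchemeOver ℂ} (θZ : complexBetti Z 2) (η : complexBetti W 2) {b' : ℕ}
  (z : complexBetti W (2 * b'))

/-- **Binomial expansion of `L_θᴹ`, span form.** For `θ = fst^* θ_Z + snd^* η` on `Z ⊗ W` (`θ_Z ∈ N¹(Z)`),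
`a ∈ Nˢ(Z)` and the class `a ⊠ L_ηᵗ z = fst^* a ∪ snd^*(L_ηᵗ z)` of codimension index `q = s + b' + t`, the
class `L_θᴹ (a ⊠ L_ηᵗ z)` lies in the `ℂ`-span of the classes `a' ⊠ L_η^{t'} z` of index `q + M` (`a'`
algebraic on `Z`): `L_θ (a ⊠ w) = L_{θ_Z} a ⊠ w + a ⊠ L_η w` (`lefschetzPowTo_boxSum_cross`) with `L_{θ_Z} a`
again algebraic (`N¹ ∪ Nˢ ⊆ Nˢ⁺¹`, granted the multiplicativity of algebraic classes), and induction on `M`.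
[cite: Andre1996Motifs, §1.3 (pp. 12–13) and proof of Prop. 2.1 (p. 15)] [cite: VoisinHodgeII2003, §9.2.4 Prop. 9.20] -/
theorem lefschetzPowTo_boxSum_cross_mem_span (hV : Voisin2003_cupProduct_algebraicClasses)
    (hZ : IsSmoothProjective l Z) (hθZ : θZ ∈ algebraicClasses Z 1) (M : ℕ) :
    ∀ (s t q : ℕ) (hq : s + b' + t = q) (a : complexBetti Z (2 * s)), a ∈ algebraicClasses Z s →
      ∀ (K : ℕ) (hK : q + M = K),
        lefschetzPowTo (complexBetti.map (fst Z W) 2 θZ + complexBetti.map (snd Z W) 2 η) M (2 * q) (2 * K)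
            (by omega)
            (cupProduct (show 2 * s + 2 * (b' + t) = 2 * q by omega) (complexBetti.map (fst Z W) (2 * s) a)
              (complexBetti.map (snd Z W) (2 * (b' + t))
                (lefschetzPowTo η t (2 * b') (2 * (b' + t)) (by omega) z))) ∈
          Submodule.span ℂ {x : complexBetti (Z ⊗ W) (2 * K) |
            ∃ (s₁ t₁ : ℕ) (_ : s₁ + b' + t₁ = K) (a₁ : complexBetti Z (2 * s₁)),
              a₁ ∈ algebraicClasses Z s₁ ∧
                x = cupProduct (show 2 * s₁ + 2 * (b' + t₁) = 2 * K by omega)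
                  (complexBetti.map (fst Z W) (2 * s₁) a₁)
                  (complexBetti.map (snd Z W) (2 * (b' + t₁))
                    (lefschetzPowTo η t₁ (2 * b') (2 * (b' + t₁)) (by omega) z))} := by
  induction M with
  | zero =>
    intro s t q hq a ha K hK
    obtain rfl : K = q := by omega
    rw [lefschetzPowTo_zero_eq_id, LinearMap.id_apply]
    exact Submodule.subset_span ⟨s, t, hq, a, ha, rfl⟩
  | succ M ih =>
    intro s t q hq a ha K hK
    -- `L^{M+1} x = L^M (L x)` and `L x = L_{θ_Z} a ⊠ L^t z + a ⊠ L^{t+1} z`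
    rw [← lefschetzPowTo_comp_apply _ (show 1 + M = M + 1 by omega)
        (show 2 * q + 2 * 1 = 2 * (q + 1) by omega) (show 2 * (q + 1) + 2 * M = 2 * K by omega),
      lefschetzPowTo_boxSum_cross θZ η (show 2 * s + 2 * (b' + t) = 2 * q by omega)
        (show 2 * s + 2 * 1 = 2 * (s + 1) by omega) (show 2 * (b' + t) + 2 * 1 = 2 * (b' + (t + 1)) by omega)
        (show 2 * q + 2 * 1 = 2 * (q + 1) by omega) (by omega) (by omega),
      lefschetzPowTo_comp_apply η (show t + 1 = t + 1 from rfl) (show 2 * b' + 2 * t = 2 * (b' + t) by omega)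
        (show 2 * (b' + t) + 2 * 1 = 2 * (b' + (t + 1)) by omega)
        (show 2 * b' + 2 * (t + 1) = 2 * (b' + (t + 1)) by omega) z,
      map_add]
    refine Submodule.add_mem _ (ih (s + 1) t (q + 1) (by omega) _ ?_ K (by omega))
      (ih s (t + 1) (q + 1) (by omega) a ha K (by omega))
    exact lefschetzPowTo_mem_algebraicClasses_of_cupProduct hV hZ hθZ 1 s (by omega) ha

/-- **The top slice is algebraic.** If `L_ηᵗ z ∈ N^{b'+t}(W)` for all `t ≥ N`, then every class
`a ⊠ L_ηᵗ z` of codimension index `K ≥ l + b' + N` (`a ∈ Nˢ(Z)`, `s + b' + t = K`) is algebraic on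
`Z ⊗ W`: either `s > l = dim Z` and `a = 0` (`H^{2s}(Z(ℂ)) = 0`), or `t ≥ N` and the class is a product of
flat pull-backs of algebraic classes (`map_fst_mem_supportedClasses`, `map_snd_mem_supportedClasses`, and the
multiplicativity of algebraic classes). [cite: VoisinHodgeII2003, §9.2.4 Prop. 9.20] [cite: HatcherAT2002, §3.3 Thm. 3.26] -/
theorem span_boxSum_cross_le_algebraicClasses (hV : Voisin2003_cupProduct_algebraicClasses)
    (hZ : IsSmoothProjective l Z) (hW : IsSmoothProjective d W) {N : ℕ}
    (hz : ∀ u : ℕ, lefschetzPowTo η (N + u) (2 * b') (2 * (b' + (N + u))) (by omega) z ∈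
      algebraicClasses W (b' + (N + u)))
    {K : ℕ} (hK : l + b' + N ≤ K) :
    Submodule.span ℂ {x : complexBetti (Z ⊗ W) (2 * K) |
        ∃ (s₁ t₁ : ℕ) (_ : s₁ + b' + t₁ = K) (a₁ : complexBetti Z (2 * s₁)),
          a₁ ∈ algebraicClasses Z s₁ ∧
            x = cupProduct (show 2 * s₁ + 2 * (b' + t₁) = 2 * K by omega)
              (complexBetti.map (fst Z W) (2 * s₁) a₁)
              (complexBetti.map (snd Z W) (2 * (b' + t₁))
                (lefschetzPowTo η t₁ (2 * b') (2 * (b' + t₁)) (by omega) z))} ≤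
      algebraicClasses (Z ⊗ W) K := by
  have hZW : IsSmoothProjective (l + d) (Z ⊗ W) := IsSmoothProjective.tensor_holds hZ hW
  rw [Submodule.span_le]
  rintro _ ⟨s₁, t₁, hq, a₁, ha₁, rfl⟩
  by_cases hs : s₁ ≤ l
  · -- `t₁ ≥ N`: a product of flat pull-backs of algebraic classes
    obtain ⟨u, rfl⟩ : ∃ u, t₁ = N + u := ⟨t₁ - N, by omega⟩
    have h1 : complexBetti.map (fst Z W) (2 * s₁) a₁ ∈ algebraicClasses (Z ⊗ W) s₁ :=
      map_fst_mem_supportedClasses hZ hW ha₁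
    have h2 : complexBetti.map (snd Z W) (2 * (b' + (N + u)))
        (lefschetzPowTo η (N + u) (2 * b') (2 * (b' + (N + u))) (by omega) z) ∈
        algebraicClasses (Z ⊗ W) (b' + (N + u)) :=
      map_snd_mem_supportedClasses hZ hW (hz u)
    exact (cupProduct_mem_supportedClasses_congr (two_mul_add_two_mul s₁ (b' + (N + u))) _
      (show s₁ + (b' + (N + u)) = K by omega) _ _).1 (hV hZW h1 h2)
  · -- `s₁ > dim Z`: the first factor vanishes
    haveI := subsingleton_complexBetti hZ (show 2 * l < 2 * s₁ by omega)
    rw [Subsingleton.elim a₁ 0, map_zero, map_zero, LinearMap.zero_apply]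
    exact Submodule.zero_mem _

end TopSlice

/-! ## §2 Lemme 1.3.2 for the pair `(*_η β, [Z])` above the middle degree -/

/-- **Lemme 1.3.2 for the pair `(*_η β, [Z])`, ABOVE the middle degree** (the half `b > b'` of the
hypothesis `h132` of `motivatedPullbackFst_core_of_lemma132`): for `Z`, `W` smooth projective of dimensions
`l`, `d`, a polarisation class `η` of `W`, `b + b' = d` with `b' < b`, and `β ∈ Nᵇ H²ᵇ(W(ℂ); ℂ)`, the class
`S = pr_W^*(*_η β) ∈ H^{2b'}((Z ⊗ W)(ℂ))` lies in the span of the classes `γ ∪ *_θ δ` (`θ` a polarisation class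
of `Z ⊗ W`, `γ`, `δ` algebraic). Here `*_η β = (L_η^{b-b'})⁻¹ β` (André §1.1: above the middle degree `*_L` is the
inverse Lefschetz isomorphism), so `L_ηᵗ(*_η β) = L_η^{t-(b-b')} β` is algebraic for `t ≥ b - b'`; with
`θ = η_Z ⊠ 1 + 1 ⊠ η` the exterior sum of the hyperplane class `η_Z` of `Z` (`nonempty_hardLefschetzNFold_holds`)
and `η` — a POLARISATION CLASS of the `(l+d)`-fold `Z ⊗ W` by `isPolarizationClass_boxSum` — the class
`δ = L_θ^{l+b-b'} S` is algebraic (§1: its binomial expansion only involves `η_Zⁱ ⊠ L_η^{l+b-b'-i} β`,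
`i ≤ l`), and `S = *_θ δ = 1 ∪ *_θ δ` since `S` sits in degree `2b' = (l + d) - (l + b - b')` below the middle.
[cite: Andre1996Motifs, §1.1 (p. 10), Lemme 1.3.2 (p. 13) and proof of Prop. 2.1 (p. 15)]
[cite: Kleiman1968AlgebraicCycles, Thm. 2.9] [cite: VoisinHodgeII2003, §9.2.4 Prop. 9.20] -/
theorem lemma132_pair_of_lt (hV : Voisin2003_cupProduct_algebraicClasses) ⦃l d : ℕ⦄
    ⦃Z W : SchemeOver ℂ⦄ (hZ : IsSmoothProjective l Z) (hW : IsSmoothProjective d W)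
    ⦃η : complexBetti W 2⦄ (hη : IsPolarizationClass d W η) ⦃b b' : ℕ⦄ (hbb' : b + b' = d)
    (hlt : b' < b) ⦃β : complexBetti W (2 * b)⦄ (hβ : β ∈ algebraicClasses W b) :
    complexBetti.map (snd Z W) (2 * b')
        (lefschetzInvolution hη.hasHardLefschetz (show 2 * b + 2 * b' = 2 * d by omega) β) ∈
      Submodule.span ℂ {s : complexBetti (Z ⊗ W) (2 * b') |
        ∃ (θ : complexBetti (Z ⊗ W) 2) (hθ : IsPolarizationClass (l + d) (Z ⊗ W) θ) (c e e' : ℕ)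
          (_ : c + e' = b') (_ : e + e' = l + d) (γ : complexBetti (Z ⊗ W) (2 * c))
          (δ : complexBetti (Z ⊗ W) (2 * e)),
          γ ∈ algebraicClasses (Z ⊗ W) c ∧ δ ∈ algebraicClasses (Z ⊗ W) e ∧
            s = cupProduct (show 2 * c + 2 * e' = 2 * b' by omega) γ
              (lefschetzInvolution hθ.hasHardLefschetz
                (show 2 * e + 2 * e' = 2 * (l + d) by omega) δ)} := by
  have hZW : IsSmoothProjective (l + d) (Z ⊗ W) := IsSmoothProjective.tensor_holds hZ hW
  obtain ⟨N, rfl⟩ : ∃ N, b = b' + N := ⟨b - b', by omega⟩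
  -- the exterior-sum polarisation `θ = η_Z ⊠ 1 + 1 ⊠ η`
  obtain ⟨ΛZ⟩ := nonempty_hardLefschetzNFold_holds l Z hZ
  have hθ : IsPolarizationClass (l + d) (Z ⊗ W)
      (complexBetti.map (fst Z W) 2 ΛZ.hyperplaneClass + complexBetti.map (snd Z W) 2 η) :=
    isPolarizationClass_boxSum hZ hW ΛZ.isPolarizationClass hη
  set z := lefschetzInvolution hη.hasHardLefschetz (show 2 * (b' + N) + 2 * b' = 2 * d by omega) β with hz_def
  set S := complexBetti.map (snd Z W) (2 * b') z with hS_def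
  -- `L_ηᴺ z = β`, hence `L_η^{N+u} z = L_ηᵘ β` is algebraic
  have hLN : ∀ (m : ℕ) (hm : 2 * b' + 2 * N = m) (hab : m + 2 * b' = 2 * d) (y : complexBetti W m),
      lefschetzPowTo η N (2 * b') m hm (lefschetzInvolution hη.hasHardLefschetz hab y) = y := by
    rintro m rfl hab y
    exact lefschetzPow_lefschetzInvolution hη.hasHardLefschetz (by omega) hab y
  have hz : ∀ u : ℕ, lefschetzPowTo η (N + u) (2 * b') (2 * (b' + (N + u))) (by omega) z ∈
      algebraicClasses W (b' + (N + u)) := by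
    intro u
    rw [← lefschetzPowTo_comp_apply η (show N + u = N + u from rfl) (show 2 * b' + 2 * N = 2 * (b' + N) by omega)
      (show 2 * (b' + N) + 2 * u = 2 * (b' + (N + u)) by omega), hz_def, hLN]
    exact (lefschetzPowTo_mem_supportedClasses_congr η (show 2 * (b' + N) + 2 * u = 2 * (b' + N + u) by omega)
      _ (show b' + N + u = b' + (N + u) by omega) β).1
      (lefschetzPowTo_mem_algebraicClasses_of_cupProduct hV hW hη.mem_algebraicClasses u (b' + N) (by omega) hβ)
  -- `δ = L_θ^{l+N} S` is algebraic
  have h1Z : (singularCohomology.one ℂ (ComplexPoints Z) : complexBetti Z (2 * 0)) ∈ algebraicClasses Z 0 := by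
    rw [algebraicClasses_zero]; trivial
  have hgen := lefschetzPowTo_boxSum_cross_mem_span ΛZ.hyperplaneClass η z hV hZ ΛZ.hyperplaneClass_mem
    (l + N) 0 0 b' (by omega) _ h1Z (l + (b' + N)) (by omega)
  have hS0 : cupProduct (show 2 * 0 + 2 * (b' + 0) = 2 * b' by omega)
      (complexBetti.map (fst Z W) (2 * 0) (singularCohomology.one ℂ (ComplexPoints Z)))
      (complexBetti.map (snd Z W) (2 * (b' + 0)) (lefschetzPowTo η 0 (2 * b') (2 * (b' + 0)) (by omega) z)) = S := by
    change cupProduct (Nat.zero_add (2 * b'))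
      (singularCohomology.map ℂ ℂ (AlgPoints.mapContinuous (L := ℂ) (fst Z W)) 0
        (singularCohomology.one ℂ (ComplexPoints Z))) S = S
    rw [singularCohomology.map_one, one_cupProduct]
  rw [hS0] at hgen
  have hδ : lefschetzPowTo (complexBetti.map (fst Z W) 2 ΛZ.hyperplaneClass + complexBetti.map (snd Z W) 2 η)
      (l + N) (2 * b') (2 * (l + (b' + N))) (by omega) S ∈ algebraicClasses (Z ⊗ W) (l + (b' + N)) :=
    span_boxSum_cross_le_algebraicClasses η z hV hZ hW hz (by omega) hgen
  -- `S = *_θ δ = 1 ∪ *_θ δ`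
  have hstar : lefschetzInvolution hθ.hasHardLefschetz (show 2 * (l + (b' + N)) + 2 * b' = 2 * (l + d) by omega)
      (lefschetzPowTo (complexBetti.map (fst Z W) 2 ΛZ.hyperplaneClass + complexBetti.map (snd Z W) 2 η)
        (l + N) (2 * b') (2 * (l + (b' + N))) (by omega) S) = S :=
    lefschetzInvolution_lefschetzPowTo hθ.hasHardLefschetz (by omega) _ _ _ S
  have h1 : (singularCohomology.one ℂ (ComplexPoints (Z ⊗ W)) : complexBetti (Z ⊗ W) (2 * 0)) ∈
      algebraicClasses (Z ⊗ W) 0 := by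
    rw [algebraicClasses_zero]; trivial
  refine Submodule.subset_span ⟨_, hθ, 0, l + (b' + N), b', by omega, by omega, _, _, h1, hδ, ?_⟩
  rw [hstar, one_cupProduct]

/-- **Lemme 1.3.2 for the pair `(*_η β, [Z])`, all degrees**: the hypothesis `h132` of
`motivatedPullbackFst_core_of_lemma132` (`lemma132_pair_of_le` below the middle, `lemma132_pair_of_lt` above).
[cite: Andre1996Motifs, Lemme 1.3.2 (p. 13) and proof of Prop. 2.1 (p. 15)] -/
theorem lemma132_pair (hV : Voisin2003_cupProduct_algebraicClasses) ⦃l d : ℕ⦄ ⦃Z W : SchemeOver ℂ⦄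
    (hZ : IsSmoothProjective l Z) (hW : IsSmoothProjective d W) ⦃η : complexBetti W 2⦄
    (hη : IsPolarizationClass d W η) ⦃b b' : ℕ⦄ (hbb' : b + b' = d) ⦃β : complexBetti W (2 * b)⦄
    (hβ : β ∈ algebraicClasses W b) :
    complexBetti.map (snd Z W) (2 * b')
        (lefschetzInvolution hη.hasHardLefschetz (show 2 * b + 2 * b' = 2 * d by omega) β) ∈
      Submodule.span ℂ {s : complexBetti (Z ⊗ W) (2 * b') |
        ∃ (θ : complexBetti (Z ⊗ W) 2) (hθ : IsPolarizationClass (l + d) (Z ⊗ W) θ) (c e e' : ℕ)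
          (_ : c + e' = b') (_ : e + e' = l + d) (γ : complexBetti (Z ⊗ W) (2 * c))
          (δ : complexBetti (Z ⊗ W) (2 * e)),
          γ ∈ algebraicClasses (Z ⊗ W) c ∧ δ ∈ algebraicClasses (Z ⊗ W) e ∧
            s = cupProduct (show 2 * c + 2 * e' = 2 * b' by omega) γ
              (lefschetzInvolution hθ.hasHardLefschetz
                (show 2 * e + 2 * e' = 2 * (l + d) by omega) δ)} := by
  rcases le_or_gt b b' with hle | hlt
  · exact lemma132_pair_of_le hV hZ hW hη hbb' hle hβ
  · exact lemma132_pair_of_lt hV hZ hW hη hbb' hlt hβ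

/-! ## §3 Prop. 2.1 (ii), first inclusion, and the named fact (A5) -/

/-- **The Künneth core of André's Prop. 2.1 (ii), first inclusion** (the hypothesis `hcore` of
`motivatedPullbackFst_of_core`): for generator data `Z`, `X`, `Y`, `μ`, `η`, `α`, `β` the class
`(Z ◁ pr_X)_*(pr_{XY}^* α ∪ pr_{XY}^*(*_η β))` is motivated on `Z ⊗ X` — `motivatedPullbackFst_core_of_lemma132`
fed with `lemma132_pair` and the proved multiplicativity of algebraic classes.
[cite: Andre1996Motifs, Prop. 2.1 (ii) (p. 14) and proof (p. 15)] -/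
theorem motivatedPullbackFst_core ⦃l n m : ℕ⦄ ⦃Z X Y : SchemeOver ℂ⦄ (hZ : IsSmoothProjective l Z)
    (hX : IsSmoothProjective n X) (hY : IsSmoothProjective m Y) (μ : OrientationFamily)
    ⦃η : complexBetti (X ⊗ Y) 2⦄ (hη : IsPolarizationClass (n + m) (X ⊗ Y) η) ⦃a b b' p : ℕ⦄
    (hbb' : b + b' = n + m) (hab : a + b' = p + m) (hp : p ≤ n) ⦃α : complexBetti (X ⊗ Y) (2 * a)⦄
    ⦃β : complexBetti (X ⊗ Y) (2 * b)⦄ (hα : α ∈ algebraicClasses (X ⊗ Y) a)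
    (hβ : β ∈ algebraicClasses (X ⊗ Y) b) :
    complexGysin μ (IsSmoothProjective.tensor_holds hZ (IsSmoothProjective.tensor_holds hX hY))
        (IsSmoothProjective.tensor_holds hZ hX) (Z ◁ fst X Y)
        (show 2 * (p + m) + 2 * (l + n) = 2 * p + 2 * (l + (n + m)) by omega)
        (cupProduct (show 2 * a + 2 * b' = 2 * (p + m) by omega)
          (complexBetti.map (snd Z (X ⊗ Y)) (2 * a) α)
          (complexBetti.map (snd Z (X ⊗ Y)) (2 * b')
            (lefschetzInvolution hη.hasHardLefschetz (show 2 * b + 2 * b' = 2 * (n + m) by omega) β))) ∈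
      motivatedClasses (l + n) (Z ⊗ X) p :=
  motivatedPullbackFst_core_of_lemma132 Voisin2003_cupProduct_algebraicClasses_holds'
    (lemma132_pair Voisin2003_cupProduct_algebraicClasses_holds') hZ hX hY μ hη hbb' hab hp hα hβ

/-- **André's Prop. 2.1 (ii), first inclusion, on the real carriers: `pr_X^*(A_motᵖ(X)_ℂ) ⊆ A_motᵖ(X ⊗ Z)_ℂ`**
for `X`, `Z` smooth projective complex varieties — unconditionally (`motivatedPullbackFst_of_core` with
`motivatedPullbackFst_core`). This closes the hypothesis `hpull` of the stub `stub_motivatedPullbackFst` of the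
crux `SummitOffWeilSector` (stmt-HodgeConjecture-14374, line `motivated-anchor-split`).
[cite: Andre1996Motifs, Prop. 2.1 (ii) (p. 14) and proof (p. 15)] -/
theorem map_fst_mem_motivatedClasses ⦃n l : ℕ⦄ ⦃X Z : SchemeOver ℂ⦄ (hX : IsSmoothProjective n X)
    (hZ : IsSmoothProjective l Z) (p : ℕ) ⦃x : complexBetti X (2 * p)⦄ (hx : x ∈ motivatedClasses n X p) :
    complexBetti.map (fst X Z) (2 * p) x ∈ motivatedClasses (n + l) (X ⊗ Z) p :=
  motivatedPullbackFst_of_core motivatedPullbackFst_core hX hZ p x hx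

/-- **Prop. 2.1 (ii), first inclusion, for the second projection: `pr_X^*(A_motᵖ(X)_ℂ) ⊆ A_motᵖ(Z ⊗ X)_ℂ`**
(the swap `Z ⊗ X ≅ X ⊗ Z` transports motivated classes, `map_mem_motivatedClasses_of_iso`).
[cite: Andre1996Motifs, Prop. 2.1 (ii) (p. 14)] -/
theorem map_snd_mem_motivatedClasses ⦃n l : ℕ⦄ ⦃X Z : SchemeOver ℂ⦄ (hX : IsSmoothProjective n X)
    (hZ : IsSmoothProjective l Z) (p : ℕ) ⦃x : complexBetti X (2 * p)⦄ (hx : x ∈ motivatedClasses n X p) :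
    complexBetti.map (snd Z X) (2 * p) x ∈ motivatedClasses (l + n) (Z ⊗ X) p := by
  have hXZ : IsSmoothProjective (l + n) (X ⊗ Z) := by
    rw [Nat.add_comm]
    exact IsSmoothProjective.tensor_holds hX hZ
  have hZX : IsSmoothProjective (l + n) (Z ⊗ X) := IsSmoothProjective.tensor_holds hZ hX
  obtain ⟨σ, hσ⟩ : ∃ σ : Z ⊗ X ≅ X ⊗ Z, σ.hom ≫ fst X Z = snd Z X :=
    ⟨⟨lift (snd Z X) (fst Z X), lift (snd X Z) (fst X Z),
      CartesianMonoidalCategory.hom_ext _ _ (by simp) (by simp),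
      CartesianMonoidalCategory.hom_ext _ _ (by simp) (by simp)⟩, lift_fst _ _⟩
  have h1 : complexBetti.map (fst X Z) (2 * p) x ∈ motivatedClasses (l + n) (X ⊗ Z) p := by
    have h := map_fst_mem_motivatedClasses hX hZ p hx
    rwa [Nat.add_comm n l] at h
  rw [← hσ, complexBetti.map_comp, CategoryTheory.comp_apply]
  exact map_mem_motivatedClasses_of_iso hXZ hZX σ h1

/-- **The named fact `Andre1996_motivatedClasses_pullback` (André 1996, Prop. 2.1 (ii) with p. 15: motivated
classes are stable under pull-back along any morphism of smooth projective complex varieties) HOLDS** — the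
graph formalism `j^* = [Γ_j]^*` (`andreMotivatedPullback_of_cupProduct_of_mapFst`, proved in the tree) fed with
the multiplicativity of algebraic classes (`Voisin2003_cupProduct_algebraicClasses_holds'`) and Prop. 2.1 (ii),
first inclusion (`map_fst_mem_motivatedClasses`). This discharges the leaf (A5) of the tree's derivation
`Andre1996_deformation_holds_of` of André's deformation theorem (Thm. 0.5).
[cite: Andre1996Motifs, Prop. 2.1 (ii) (p. 14) and p. 15] -/
theorem _root_.Literature.AlgebraicGeometry.HodgeTheory.Andre1996_motivatedClasses_pullback_holds :
    Andre1996_motivatedClasses_pullback :=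
  andreMotivatedPullback_of_cupProduct_of_mapFst Voisin2003_cupProduct_algebraicClasses_holds'
    map_fst_mem_motivatedClasses

/-- **`f^*(A_motᵖ(X)_ℂ) ⊆ A_motᵖ(X')_ℂ`** for any morphism `f : X' ⟶ X` of smooth projective complex varieties
(André 1996, Prop. 2.1 (ii) and p. 15; the named fact unfolded). [cite: Andre1996Motifs, Prop. 2.1 (ii) (p. 14) and p. 15] -/
theorem map_mem_motivatedClasses ⦃m n : ℕ⦄ ⦃X X' : SchemeOver ℂ⦄ (f : X' ⟶ X)
    (hX : IsSmoothProjective m X) (hX' : IsSmoothProjective n X') (p : ℕ) ⦃x : complexBetti X (2 * p)⦄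
    (hx : x ∈ motivatedClasses m X p) : complexBetti.map f (2 * p) x ∈ motivatedClasses n X' p :=
  Andre1996_motivatedClasses_pullback_holds f hX hX' p x hx

end Literature.AlgebraicGeometry.HodgeTheory.MotivatedPullback

end
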